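import Literature.Topology.FourManifolds.EuclideanIsotopyExtension
import Literature.Topology.FourManifolds.FrameSignsAlongPaths

/-!
# Stub `stub_cleanOnePleatIroning` of line `shadow-pleats` for crux `OrigamiFoldExistence` — VII:
# isotopy extension in `ℝᵏ⁺¹` by an ORIENTATION-PRESERVING diffeomorphism
(item stmt-SmoothPoincare4-7844, route SymplecticOrigami; seat c3, S5a worker, wave 2)

Seventh helper file for the registered stub `stub_cleanOnePleatIroning` (S5a).  Step (S2) of
the SMOOTH HALF of its remaining ingredient `CleanPleatIroningChart` (file III,
`…StubCleanOnePleatIroningDeletion`) carries the standard ball bounded by the tiny sphere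
`proj5 ι e₀(S_{r₀})` onto the region bounded by the crease `proj5 ι e₀(S_R)` by the
diffeomorphism `θ` of `ℝ⁴` that the tree's Euclidean isotopy extension theorem
(`Literature.Topology.FourManifolds.exists_diffeomorph_comp_eq_of_smoothIsotopy_euclidean`)
attaches to the radial isotopy of file VI.  The SIDE on which the chart collar meets the crease
(step (T1)) is then decided by an orientation count, which needs one more piece of information
about `θ` that the tree's statement forgets: **`θ` is the time-one map of an ambient isotopy,
hence ORIENTATION-PRESERVING** — `det dθ(y) > 0` at every point.  This file re-runs the tree's
proof (transport into the sphere `Sᵏ⁺¹` by the inverse stereographic parametrisation, isotopy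
extension with support in the chart domain, conjugation back) keeping the whole conjugated
family `Θ_t = c ∘ Ψ_t ∘ c⁻¹`, `t ∈ [0, 1]`: it is jointly smooth, `Θ₀ = id`, every `dΘ_t(y)`
is invertible, so `t ↦ det dΘ_t(y)` is continuous and zero-free on `[0, 1]` with value `1` at
`t = 0`, hence positive at `t = 1`.

* `exists_diffeomorph_comp_eq_det_pos` — for a smooth isotopy `F` from `f` to `g` (maps of a
  compact boundaryless manifold into `ℝᵏ⁺¹`) there is a diffeomorphism `θ` of `ℝᵏ⁺¹` with
  `θ ∘ f = g` and `0 < det (fderiv ℝ θ y)` for all `y` (registered sub-goal).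

Sources: M. W. Hirsch, *Differential Topology* (1976), Ch. 8 §1, Thms. 1.3–1.4; J. Milnor,
*Lectures on the h-cobordism theorem* (1965), Thm. 5.8; the tree file
`Literature/Topology/FourManifolds/EuclideanIsotopyExtension.lean` (whose proof is followed
verbatim up to the orientation bookkeeping); `det ≠ 0` for injective endomorphisms is the
tree's `Literature.Topology.FourManifolds.det_ne_zero_of_injective` (`FrameSignsAlongPaths`).
-/

noncomputable section

-- the prescribed namespace `Summit.<P>.<Sub>.…` duplicates `SmoothPoincare4` (P = Sub)
set_option linter.dupNamespace false

open Set Function Metric Module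
open scoped Manifold ContDiff Topology

namespace Summit.SmoothPoincare4.SmoothPoincare4.Theorems.OrigamiFoldExistence.ShadowPleats

open Literature.Topology.FourManifolds

variable {k : ℕ}

/-! ### The conjugated ambient isotopy and its orientation -/

section Conj

variable {EM : Type*} [NormedAddCommGroup EM] [NormedSpace ℝ EM] [FiniteDimensional ℝ EM]
  {HM : Type*} [TopologicalSpace HM] {I : ModelWithCorners ℝ EM HM} [I.Boundaryless]
  {M : Type*} [TopologicalSpace M] [ChartedSpace HM M] [IsManifold I ∞ M] [CompactSpace M]

open scoped EuclideanSpace in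
/-- **Isotopy extension in `ℝᵏ⁺¹` by an orientation-preserving diffeomorphism.**  If
`f, g : M → ℝᵏ⁺¹` are smoothly isotopic maps of a compact boundaryless manifold, there is a
diffeomorphism `θ` of `ℝᵏ⁺¹` with `θ ∘ f = g` AND `det dθ > 0` everywhere: `θ` is the time-one
map `c ∘ Ψ₁ ∘ c⁻¹` of the conjugate of an ambient isotopy `Ψ` of the sphere `Sᵏ⁺¹` fixing the
point at infinity (tree: `exists_ambientIsotopy_comp_eq_of_subset`), and along the jointly
smooth family `t ↦ c ∘ Ψ_t ∘ c⁻¹` of local diffeomorphisms starting at the identity the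
determinant of the differential at a fixed point is continuous and zero-free, hence stays
positive. [cite: HirschDT1976, Ch. 8 §1, Thm. 1.3] -/
theorem exists_diffeomorph_comp_eq_det_pos
    {f g : M → EuclideanSpace ℝ (Fin (k + 1))} (F : SmoothIsotopy I (𝓡 (k + 1)) f g) :
    ∃ θ : EuclideanSpace ℝ (Fin (k + 1)) ≃ₘ⟮𝓡 (k + 1), 𝓡 (k + 1)⟯
      EuclideanSpace ℝ (Fin (k + 1)), θ ∘ f = g ∧
        ∀ y, 0 < (fderiv ℝ (θ : EuclideanSpace ℝ (Fin (k + 1)) → EuclideanSpace ℝ (Fin (k + 1))) y).det := by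
  haveI : CompleteSpace EM := FiniteDimensional.complete ℝ EM
  set c := polarStereoChart k with hc
  -- extend the transported isotopy inside the chart domain of the sphere
  obtain ⟨Ψ, hΨ, hfix⟩ := exists_ambientIsotopy_comp_eq_of_subset F.stereo c.open_source
    (fun t x => polarStereoChart_symm_mem_source (F.toFun t x))
  -- every stage and its inverse preserve the chart domain (they fix its complement pointwise)
  have hsrc : ∀ t y, y ∈ c.source → Ψ.toFun t y ∈ c.source := by
    intro t y hy
    by_contra h
    have h1 : Ψ.toFun t y = y := (Ψ.bijective t).1 (hfix t _ h)
    rw [h1] at h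
    exact h hy
  have hsrc' : ∀ t y, y ∈ c.source → (Ψ.toDiffeomorph t).symm y ∈ c.source := by
    intro t y hy
    by_contra h
    have h1 : Ψ.toFun t ((Ψ.toDiffeomorph t).symm y) = (Ψ.toDiffeomorph t).symm y := hfix t _ h
    rw [← AmbientIsotopy.coe_toDiffeomorph, Diffeomorph.apply_symm_apply] at h1
    rw [← h1] at h
    exact h hy
  -- the conjugated family `Θ t = c ∘ Ψ_t ∘ c⁻¹` and the conjugated inverses
  set Θ : ℝ → EuclideanSpace ℝ (Fin (k + 1)) → EuclideanSpace ℝ (Fin (k + 1)) :=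
    fun t y => c (Ψ.toFun t (c.symm y)) with hΘ
  set Θi : ℝ → EuclideanSpace ℝ (Fin (k + 1)) → EuclideanSpace ℝ (Fin (k + 1)) :=
    fun t y => c ((Ψ.toDiffeomorph t).symm (c.symm y)) with hΘi
  have hleft : ∀ t y, Θi t (Θ t y) = y := by
    intro t y
    simp only [hΘ, hΘi]
    rw [c.left_inv (hsrc t _ (polarStereoChart_symm_mem_source y)),
      ← AmbientIsotopy.coe_toDiffeomorph, Diffeomorph.symm_apply_apply,
      polarStereoChart_apply_symm]
  have hright : ∀ t y, Θ t (Θi t y) = y := by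
    intro t y
    simp only [hΘ, hΘi]
    rw [c.left_inv (hsrc' t _ (polarStereoChart_symm_mem_source y)),
      ← AmbientIsotopy.coe_toDiffeomorph, Diffeomorph.apply_symm_apply,
      polarStereoChart_apply_symm]
  have hΘ_smooth : ∀ t, ContMDiff (𝓡 (k + 1)) (𝓡 (k + 1)) ∞ (Θ t) := fun t =>
    contMDiffOn_polarStereoChart.comp_contMDiff
      ((Ψ.contMDiff_toFun t).comp contMDiff_polarStereoChart_symm)
      fun y => hsrc t _ (polarStereoChart_symm_mem_source y)
  have hΘi_smooth : ∀ t, ContMDiff (𝓡 (k + 1)) (𝓡 (k + 1)) ∞ (Θi t) := fun t =>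
    contMDiffOn_polarStereoChart.comp_contMDiff
      ((Ψ.toDiffeomorph t).symm.contMDiff.comp contMDiff_polarStereoChart_symm)
      fun y => hsrc' t _ (polarStereoChart_symm_mem_source y)
  -- joint smoothness of the conjugated family
  have hΘ_joint : ContMDiff (𝓘(ℝ, ℝ).prod (𝓡 (k + 1))) (𝓡 (k + 1)) ∞ (uncurry Θ) := by
    have h1 : ContMDiff (𝓘(ℝ, ℝ).prod (𝓡 (k + 1))) (𝓘(ℝ, ℝ).prod (𝓡 (k + 1))) ∞
        (fun p : ℝ × EuclideanSpace ℝ (Fin (k + 1)) => (p.1, c.symm p.2)) :=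
      contMDiff_fst.prodMk (contMDiff_polarStereoChart_symm.comp contMDiff_snd)
    have h2 : ContMDiff (𝓘(ℝ, ℝ).prod (𝓡 (k + 1))) (𝓡 (k + 1)) ∞
        (fun p : ℝ × EuclideanSpace ℝ (Fin (k + 1)) => Ψ.toFun p.1 (c.symm p.2)) :=
      Ψ.contMDiff.comp h1
    exact contMDiffOn_polarStereoChart.comp_contMDiff h2
      fun p => hsrc p.1 _ (polarStereoChart_symm_mem_source p.2)
  have hΘ_contDiff : ContDiff ℝ ∞ (uncurry Θ) := by
    rw [← contMDiff_iff_contDiff, modelWithCornersSelf_prod, ← chartedSpaceSelf_prod]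
    exact hΘ_joint
  -- the differential of every stage is injective, hence has non-zero determinant
  have hΘ_inj : ∀ t y, Injective (fderiv ℝ (Θ t) y) := by
    intro t y
    have hn : (∞ : WithTop ℕ∞) ≠ 0 := by simp
    have hy : c.symm y ∈ c.source := polarStereoChart_symm_mem_source y
    have hΨy : Ψ.toFun t (c.symm y) ∈ c.source := hsrc t _ hy
    have hd1 : MDifferentiableAt (𝓡 (k + 1)) (𝓡 (k + 1)) c.symm y :=
      contMDiff_polarStereoChart_symm.mdifferentiableAt hn
    have hd2 : MDifferentiableAt (𝓡 (k + 1)) (𝓡 (k + 1)) (Ψ.toFun t) (c.symm y) :=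
      (Ψ.contMDiff_toFun t).mdifferentiableAt hn
    have hd3 : MDifferentiableAt (𝓡 (k + 1)) (𝓡 (k + 1)) c (Ψ.toFun t (c.symm y)) :=
      (contMDiffOn_polarStereoChart.mdifferentiableOn hn _ hΨy).mdifferentiableAt
        (c.open_source.mem_nhds hΨy)
    have hcomp : mfderiv (𝓡 (k + 1)) (𝓡 (k + 1)) (Θ t) y =
        (mfderiv (𝓡 (k + 1)) (𝓡 (k + 1)) c (Ψ.toFun t (c.symm y))).comp
          ((mfderiv (𝓡 (k + 1)) (𝓡 (k + 1)) (Ψ.toFun t) (c.symm y)).comp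
            (mfderiv (𝓡 (k + 1)) (𝓡 (k + 1)) c.symm y)) := by
      have hfun : Θ t = c ∘ (Ψ.toFun t ∘ c.symm) := rfl
      rw [hfun, mfderiv_comp y hd3 (hd2.comp y hd1), mfderiv_comp y hd2 hd1]
      rfl
    rw [← mfderiv_eq_fderiv, hcomp]
    have i1 : Injective (mfderiv (𝓡 (k + 1)) (𝓡 (k + 1)) c.symm y) :=
      mfderiv_polarStereoChart_symm_injective y
    have i2 : Injective (mfderiv (𝓡 (k + 1)) (𝓡 (k + 1)) (Ψ.toFun t) (c.symm y)) :=
      ((Ψ.isLocalDiffeomorph t (c.symm y)).mfderivToContinuousLinearEquiv hn).injective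
    have i3 : Injective (mfderiv (𝓡 (k + 1)) (𝓡 (k + 1)) c (Ψ.toFun t (c.symm y))) :=
      (mdifferentiable_chart (I := 𝓡 (k + 1)) (spherePoint k)).mfderiv_injective hΨy
    exact i3.comp (i2.comp i1)
  have hΘ_det : ∀ t y, (fderiv ℝ (Θ t) y).det ≠ 0 := fun t y =>
    det_ne_zero_of_injective (hΘ_inj t y)
  -- `Θ 0 = id`, so the determinant is `1` at time `0`
  have hΘ0 : Θ 0 = id := by
    funext y
    simp only [hΘ, Ψ.map_zero, id_eq]
    exact polarStereoChart_apply_symm y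
  -- continuity in `t` of the determinant at a fixed point, and positivity at `t = 1`
  have hdet_pos : ∀ y, 0 < (fderiv ℝ (Θ 1) y).det := by
    intro y
    have hcont : Continuous fun t : ℝ => (fderiv ℝ (Θ t) y).det := by
      have h1 : ContDiff ℝ 0 fun t : ℝ => fderiv ℝ (Θ t) y :=
        hΘ_contDiff.fderiv (contDiff_const (c := y)) (by simp)
      exact ContinuousLinearMap.continuous_det.comp h1.continuous
    have h0 : (fderiv ℝ (Θ 0) y).det = 1 := by
      rw [hΘ0, fderiv_id]
      exact LinearMap.det_id
    -- intermediate value on `[0, 1]`: a zero-free continuous function keeps its sign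
    by_contra hle
    have hle' : (fderiv ℝ (Θ 1) y).det ≤ 0 := not_lt.1 hle
    have hmem : (0 : ℝ) ∈ Icc ((fderiv ℝ (Θ 1) y).det) ((fderiv ℝ (Θ 0) y).det) := by
      rw [h0]; exact ⟨hle', zero_le_one⟩
    obtain ⟨t, -, ht⟩ := intermediate_value_Icc' zero_le_one hcont.continuousOn hmem
    exact hΘ_det t y ht
  -- the diffeomorphism `θ = Θ 1`
  refine ⟨⟨⟨Θ 1, Θi 1, hleft 1, hright 1⟩, hΘ_smooth 1, hΘi_smooth 1⟩, funext fun x => ?_,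
    fun y => hdet_pos y⟩
  -- `θ (f x) = c (Ψ₁ (ι (f x))) = c (ι (g x)) = g x`
  show c (Ψ.toFun 1 (c.symm (f x))) = g x
  have h1 : Ψ.toFun 1 ((polarStereoChart k).symm (f x)) = (polarStereoChart k).symm (g x) := by
    have := congrFun (hΨ 1 ⟨zero_le_one, le_rfl⟩) x
    simpa [F.map_one] using this
  rw [← hc] at h1
  rw [h1, polarStereoChart_apply_symm]

end Conj

end Summit.SmoothPoincare4.SmoothPoincare4.Theorems.OrigamiFoldExistence.ShadowPleats

end
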